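import Summits.PneNP.PneNP.Theorems.RamseyUncertifiableResolutionUncertaintyPinWidth
import Summits.PneNP.PneNP.Theorems.RamseyUncertifiableResolutionUncertaintyPinMonotone

/-!
# CAREFUL refutations: pins may only be dropped from clauses with few negative literals — item stmt-PneNP-9816
# `RamseyUncertifiable.ResolutionUncertainty` (support)

The SYNTACTIC form of the pin-width law (`…PinWidth.lean`). Call a resolution derivation `p`-CAREFUL (`IsCareful p π`)
if every backward step into a NON-initial premise that drops a negative literal of the conclusion (the negative pivot
excepted on the negative side) starts from a clause with at least `p` negative literals. Pin-monotone = careful for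
every `p` (`isCareful_of_isPinMonotone`); every derivation is `0`-careful.

`careful_cliqueCNF_card_cliqueFinset_le`: for every graph `G`, all `k, p ≤ t`, and every `p`-careful resolution
refutation `π` of the unary `Clique(G, k)`: `#(t-cliques of G) ≤ |π| · Σ_{e ≤ t-p} C(n, e)`.

Proof. Along Delayer `Q`'s walk, as long as no dropping step has been taken the current clause shows ALL pins acquired
so far (`showsAll_or_wide`); the first dropping step, if any, starts from a clause with `≥ p` negative literals, all of
which are pins of `Q` in distinct blocks, hence `≥ p` shown vertices; if no dropping step occurs before arrival, the
last non-initial clause shows all `|Q| = t ≥ p` pins. Either way `Q` has pin width `≥ p` (`exists_shown_ge`), and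
`card_filter_pinWidth_le` counts. Reading, on a 2-Ramsey graph with `t = Θ(log n)`: a refutation of length
`n^{o(log n)}` cannot be `(ε log₂ n)`-careful for any fixed `ε > 0` — it must drop pins from clauses carrying only
`o(log n)` negative literals, i.e. forget decisions almost as soon as they are made (as PARKING does).
-/

set_option linter.dupNamespace false

namespace Summit.PneNP.PneNP.Theorems.RamseyUncertifiableResolutionUncertainty

open Literature.Computability.Complexity Literature.Computability.MetaComplexity
open Summit.PneNP.PneNP.Theorems.RegularResolutionRung.Negative (cliqueCNF)

/-- A derivation is `p`-CAREFUL if every backward step into a NON-initial premise that drops a negative literal of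
the conclusion (for the negative premise of a resolution step: a negative literal other than the negative pivot) starts
from a clause with at least `p` negative literals. -/
def IsCareful (p : ℕ) (π : List (ResLine ℕ)) : Prop :=
  ∀ t (ht : t < π.length),
    match (π[t]'ht).rule with
    | .initial => True
    | .resolve i j v =>
        (∀ hi : i < π.length, (π[i]'hi).rule ≠ .initial →
          (∃ l ∈ (π[t]'ht).clause, l.2 = false ∧ l ∉ (π[i]'hi).clause) →
            p ≤ ((π[t]'ht).clause.filter fun l => l.2 = false).card) ∧
        (∀ hj : j < π.length, (π[j]'hj).rule ≠ .initial →
          (∃ l ∈ (π[t]'ht).clause, l.2 = false ∧ l ≠ (v, false) ∧ l ∉ (π[j]'hj).clause) →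
            p ≤ ((π[t]'ht).clause.filter fun l => l.2 = false).card)
    | .weaken i =>
        ∀ hi : i < π.length, (π[i]'hi).rule ≠ .initial →
          (∃ l ∈ (π[t]'ht).clause, l.2 = false ∧ l ∉ (π[i]'hi).clause) →
            p ≤ ((π[t]'ht).clause.filter fun l => l.2 = false).card

/-- Pin-monotone derivations are careful for every threshold (no step ever drops a negative literal). -/
theorem isCareful_of_isPinMonotone {π : List (ResLine ℕ)} (h : IsPinMonotone π) (p : ℕ) : IsCareful p π := by
  intro t ht
  have hm := h t ht
  rcases hrule : (π[t]'ht).rule with _ | ⟨i, j, v⟩ | ⟨i⟩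
  · simp only
  · rw [hrule] at hm
    obtain ⟨hmi, hmj⟩ := hm
    refine ⟨fun hi hni hex => ?_, fun hj hnj hex => ?_⟩
    · obtain ⟨l, hl, hl2, hln⟩ := hex
      exact absurd (hmi hi hni l hl hl2) hln
    · obtain ⟨l, hl, hl2, hlv, hln⟩ := hex
      exact absurd (hmj hj hnj l hl hl2 hlv) hln
  · rw [hrule] at hm
    intro hi hni hex
    obtain ⟨l, hl, hl2, hln⟩ := hex
    exact absurd (hm hi hni l hl hl2) hln

namespace TreeLike

section Step

variable {φ : CNF ℕ} {π : List (ResLine ℕ)} (ans : (ℕ → Option Bool) → ℕ → Bool) {p : ℕ}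

/-- **A careful step keeps its negative literals or starts wide.** If the walk moves from a line to a NON-initial
line `c'`, either every negative literal of the old clause is a literal of the clause of `c'`, or the old clause has at
least `p` negative literals. -/
theorem step_neg_subset_or_card (hπ : IsResDerivation φ π) (hcare : IsCareful p π) (st : ℕ × (ℕ → Option Bool))
    (hst : st.1 < π.length) {c' : ℕ} (hc' : (step π ans st).1 = c') (hlt' : c' < π.length)
    (hni : (π[c']'hlt').rule ≠ .initial) :
    (∀ l ∈ (π[st.1]'hst).clause, l.2 = false → l ∈ (π[c']'hlt').clause) ∨
      p ≤ ((π[st.1]'hst).clause.filter fun l => l.2 = false).card := by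
  classical
  have hv := hπ st.1 hst
  have hm := hcare st.1 hst
  have hlen : (π.take st.1).length = st.1 := by simp [hst.le]
  unfold IsValidResLine at hv
  unfold step at hc'
  rw [dif_pos hst] at hc'
  rcases hrule : (π[st.1]'hst).rule with _ | ⟨i, j, v⟩ | ⟨i⟩
  · rw [hrule] at hc'
    simp only [stepRule] at hc'
    subst hc'
    exact absurd hrule hni
  · rw [hrule] at hv hm hc'
    obtain ⟨hi, hj, hres⟩ := hv
    rw [List.getElem_take, List.getElem_take] at hres
    obtain ⟨-, hD, -⟩ := hres
    obtain ⟨hmi, hmj⟩ := hm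
    simp only [stepRule] at hc'
    cases hb : pivotVal ans st.2 v
    · rw [hb] at hc'
      simp only [Bool.false_eq_true, ↓reduceIte] at hc'
      subst hc'
      by_cases hex : ∃ l ∈ (π[st.1]'hst).clause, l.2 = false ∧ l ∉ (π[i]'hlt').clause
      · exact Or.inr (hmi hlt' hni hex)
      · left
        intro l hl hl2
        by_contra hln
        exact hex ⟨l, hl, hl2, hln⟩
    · rw [hb] at hc'
      simp only [↓reduceIte] at hc'
      subst hc'
      by_cases hex : ∃ l ∈ (π[st.1]'hst).clause, l.2 = false ∧ l ≠ (v, false) ∧ l ∉ (π[j]'hlt').clause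
      · exact Or.inr (hmj hlt' hni hex)
      · left
        intro l hl hl2
        by_cases hlv : l = (v, false)
        · rw [hlv]; exact hD
        · by_contra hln
          exact hex ⟨l, hl, hl2, hlv, hln⟩
  · rw [hrule] at hm hc'
    simp only [stepRule] at hc'
    subst hc'
    by_cases hex : ∃ l ∈ (π[st.1]'hst).clause, l.2 = false ∧ l ∉ (π[i]'hlt').clause
    · exact Or.inr (hm hlt' hni hex)
    · left
      intro l hl hl2
      by_contra hln
      exact hex ⟨l, hl, hl2, hln⟩

end Step

section Walk

variable {n k : ℕ} (G : SimpleGraph (Fin n)) [DecidableRel G.Adj] {π : List (ResLine ℕ)} {r : ℕ} {p : ℕ}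
  (hπ : IsResDerivation (cliqueCNF n k fun u v => decide (G.Adj u v)) π) (hr : r < π.length)
include hπ hr

/-- **Before the first drop the clause shows all acquired pins.** Along Delayer `Q`'s walk on a `p`-careful
derivation, at every time before arrival either every `true` of the record occurs negatively in the current clause,
or some earlier clause on the walk had at least `p` negative literals. -/
theorem showsAll_or_wide (hcare : IsCareful p π) (Q : Finset (Fin n)) :
    ∀ s, s < arrival n k π r Q →
      (∀ w, (run π (answer n k Q) r s).2 w = some true →
          (w, false) ∈ (π[(run π (answer n k Q) r s).1]'(run_fst_lt _ hπ hr s)).clause) ∨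
      (∃ s₀ ≤ s, p ≤ ((π[(run π (answer n k Q) r s₀).1]'(run_fst_lt _ hπ hr s₀)).clause.filter
          fun l => l.2 = false).card) := by
  intro s
  induction s with
  | zero =>
    intro _
    left
    intro w hw
    simp [run] at hw
  | succ s ih =>
    intro hs
    rcases ih (by omega) with hall | ⟨s₀, hs₀, hwide⟩
    · have hni := rule_ne_initial_of_lt_arrival G hπ hr Q hs
      rcases step_neg_subset_or_card (answer n k Q) hπ hcare (run π (answer n k Q) r s) (run_fst_lt _ hπ hr s)
          rfl (run_fst_lt _ hπ hr (s + 1)) hni with hkeep | hwide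
      · left
        intro w hw
        by_cases hold : (run π (answer n k Q) r s).2 w = some true
        · exact hkeep _ (hall w hold) rfl
        · exact step_new_true (answer n k Q) hπ (run π (answer n k Q) r s) (run_fst_lt _ hπ hr s) rfl rfl
            (run_fst_lt _ hπ hr (s + 1)) hold hw
      · exact Or.inr ⟨s, by omega, hwide⟩
    · exact Or.inr ⟨s₀, by omega, hwide⟩

/-- Negative literals of a clause on the walk, read modulo `n`, lose nothing: distinct negative literals are pins of
distinct vertices (each vertex is pinned in at most one block). -/
theorem card_image_neg_eq (hroot : (π[r]'hr).clause = ∅) (Q : Finset (Fin n)) (s : ℕ) :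
    (((π[(run π (answer n k Q) r s).1]'(run_fst_lt _ hπ hr s)).clause.filter fun l => l.2 = false).image
        fun l => l.1 % n).card =
      ((π[(run π (answer n k Q) r s).1]'(run_fst_lt _ hπ hr s)).clause.filter fun l => l.2 = false).card := by
  classical
  refine Finset.card_image_of_injOn fun l hl l' hl' heq => ?_
  rw [Finset.mem_coe, Finset.mem_filter] at hl hl'
  have hD : DInv n k Q (run π (answer n k Q) r s).2 := dInv_run _
  have hf := run_falsifies (answer n k Q) hπ hr hroot s l hl.1
  have hf' := run_falsifies (answer n k Q) hπ hr hroot s l' hl'.1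
  rw [hl.2] at hf
  rw [hl'.2] at hf'
  obtain ⟨i, hi, v, hv, -⟩ := run_true_form (r := r) (π := π) Q _ hf
  obtain ⟨i', hi', v', hv', -⟩ := run_true_form (r := r) (π := π) Q _ hf'
  have hvv : (v : ℕ) = v' := by
    have h1 : l.1 % n = (v : ℕ) := by
      rw [hv, Nat.add_mod, Nat.mul_mod_left, Nat.zero_add, Nat.mod_mod, Nat.mod_eq_of_lt v.isLt]
    have h2 : l'.1 % n = (v' : ℕ) := by
      rw [hv', Nat.add_mod, Nat.mul_mod_left, Nat.zero_add, Nat.mod_mod, Nat.mod_eq_of_lt v'.isLt]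
    have heq : l.1 % n = l'.1 % n := heq
    rw [h1, h2] at heq
    exact heq
  have hvv' : v = v' := Fin.ext hvv
  subst hvv'
  rw [hv] at hf
  rw [hv'] at hf'
  have hii : i = i' := hD.vertex i hi i' hi' v hf hf'
  subst hii
  ext
  · rw [hv, hv']
  · rw [hl.2, hl'.2]

/-- **Careful walks are wide.** On a `p`-careful refutation, every nonempty clique `Q` with `p ≤ |Q|` has pin width
`≥ p`: some clause on its walk shows at least `p` of its pins. -/
theorem exists_shown_ge (hroot : (π[r]'hr).clause = ∅) (hcare : IsCareful p π) {Q : Finset (Fin n)}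
    (hQ : G.IsClique (Q : Set (Fin n))) (hQne : Q.Nonempty) (hpQ : p ≤ Q.card) :
    ∃ s : ℕ, p ≤ (((π[(run π (answer n k Q) r s).1]'(run_fst_lt _ hπ hr s)).clause.filter
        fun l => l.2 = false).image fun l => l.1 % n).card := by
  classical
  have hpins := pins_leaf G hπ hr hroot hQ
  -- arrival is positive: otherwise the final record is empty and pins nothing
  have hA : 1 ≤ arrival n k π r Q := by
    by_contra h0
    push Not at h0
    have h0 : arrival n k π r Q = 0 := by omega
    have heq := run_eq_final_of_arrival_le G hπ hr Q (s := 0) (by omega)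
    obtain ⟨q, hq⟩ := hQne
    rw [← hpins] at hq
    simp only [pins, Finset.mem_filter, Finset.mem_univ, true_and] at hq
    obtain ⟨i, -, hi⟩ := hq
    rw [← heq] at hi
    simp [run] at hi
  rcases showsAll_or_wide G hπ hr hcare Q (arrival n k π r Q - 1) (by omega) with hall | ⟨s₀, -, hwide⟩
  · -- no drop before arrival: the last non-initial clause shows every pin of the final record, i.e. all of `Q`
    refine ⟨arrival n k π r Q - 1, ?_⟩
    have hsub : Q.image Fin.val ⊆
        (((π[(run π (answer n k Q) r (arrival n k π r Q - 1)).1]'(run_fst_lt _ hπ hr _)).clause.filter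
          fun l => l.2 = false).image fun l => l.1 % n) := by
      intro x hx
      obtain ⟨q, hq, rfl⟩ := Finset.mem_image.1 hx
      have hq' : q ∈ pins n k (run π (answer n k Q) r π.length).2 := by rw [hpins]; exact hq
      simp only [pins, Finset.mem_filter, Finset.mem_univ, true_and] at hq'
      obtain ⟨i, -, hi⟩ := hq'
      -- `x_{i,q}` is already `true` one step before arrival (a fresh `true` at the last step would sit negatively
      -- in the final block axiom)
      have htrue : (run π (answer n k Q) r (arrival n k π r Q - 1)).2 (i * n + (q : ℕ)) = some true := by
        by_contra hold
        have heqA := run_eq_final_of_arrival_le G hπ hr Q (s := arrival n k π r Q) le_rfl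
        have hnew : (run π (answer n k Q) r (arrival n k π r Q - 1 + 1)).2 (i * n + (q : ℕ)) = some true := by
          rw [Nat.sub_add_cancel hA, heqA]; exact hi
        have hmem := step_new_true (answer n k Q) hπ (run π (answer n k Q) r (arrival n k π r Q - 1))
          (run_fst_lt _ hπ hr _) rfl rfl (run_fst_lt _ hπ hr (arrival n k π r Q - 1 + 1)) hold hnew
        have hpos := final_no_neg G hπ hr hroot hQ (i * n + (q : ℕ), false) (by
          have : run π (answer n k Q) r (arrival n k π r Q - 1 + 1) = run π (answer n k Q) r π.length := by
            rw [Nat.sub_add_cancel hA]; exact heqA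
          simp only [← this]; exact hmem)
        exact Bool.false_ne_true hpos
      refine Finset.mem_image.2 ⟨(i * n + (q : ℕ), false), Finset.mem_filter.2 ⟨hall _ htrue, rfl⟩, ?_⟩
      show (i * n + (q : ℕ)) % n = (q : ℕ)
      rw [Nat.add_mod, Nat.mul_mod_left, Nat.zero_add, Nat.mod_mod, Nat.mod_eq_of_lt q.isLt]
    calc p ≤ Q.card := hpQ
      _ = (Q.image Fin.val).card := (Finset.card_image_of_injective _ Fin.val_injective).symm
      _ ≤ _ := Finset.card_le_card hsub
  · -- a wide clause on the way
    refine ⟨s₀, ?_⟩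
    rw [card_image_neg_eq G hπ hr hroot Q s₀]
    exact hwide

end Walk

end TreeLike

open scoped Classical in
/-- **Careful refutations of `Clique(G, k)` enumerate cliques up to `Σ_{e ≤ t-p} C(n,e)`.** For every graph `G` on
`Fin n`, all `k`, `p ≤ t`, and every `p`-careful resolution refutation `π` of the unary `Clique(G, k)` (pins dropped
only from clauses with `≥ p` negative literals — a purely syntactic condition; dag-like, no tree-likeness):
`#(t-cliques of G) ≤ |π| · Σ_{e ≤ t-p} C(n, e)`. At `p = t` this is `#t-cliques ≤ |π|` (every derivation being
`0`-careful, and pin-monotone ones careful for all `p`, it contains `pinMonotone_cliqueCNF_length_ge_card_cliqueFinset`). -/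
theorem careful_cliqueCNF_card_cliqueFinset_le :
    ∀ {n k : ℕ} (G : SimpleGraph (Fin n)) [DecidableRel G.Adj] (π : List (ResLine ℕ)) (p t : ℕ),
      IsResRefutation (cliqueCNF n k fun u v => decide (G.Adj u v)) π → IsCareful p π → p ≤ t →
        (G.cliqueFinset t).card ≤ π.length * (∑ e ∈ Finset.range (t - p + 1), n.choose e) := by
  intro n k G _ π p t hπ hcare hpt
  classical
  obtain ⟨hder, l, hl, hle⟩ := hπ
  obtain ⟨r, hr, rfl⟩ := List.getElem_of_mem hl
  rcases Nat.eq_zero_or_pos t with ht0 | htpos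
  · -- `t = 0`: one clique, and `|π| ≥ 1`
    subst ht0
    have hp0 : p = 0 := by omega
    subst hp0
    have h1 : (G.cliqueFinset 0).card ≤ 1 := by
      rw [Finset.card_le_one]
      intro a ha b hb
      rw [SimpleGraph.mem_cliqueFinset_iff] at ha hb
      rw [Finset.card_eq_zero.1 ha.card_eq, Finset.card_eq_zero.1 hb.card_eq]
    have h2 : 1 ≤ π.length := hr.trans_le' (Nat.zero_le _) |> fun _ => by omega
    calc (G.cliqueFinset 0).card ≤ 1 := h1
      _ ≤ π.length * (∑ e ∈ Finset.range (0 - 0 + 1), n.choose e) := by simp; omega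
  · -- `t ≥ 1`: every `t`-clique has pin width `≥ p`, then count with `card_filter_pinWidth_le`
    have hcount := card_filter_pinWidth_le G π ⟨hder, _, hl, hle⟩ t p r hr hle
    refine le_trans (Finset.card_le_card fun Q hQ => ?_) hcount
    have hQcl := (SimpleGraph.mem_cliqueFinset_iff.1 hQ)
    have hQne : Q.Nonempty := by
      rw [← Finset.card_pos, hQcl.card_eq]; exact htpos
    refine Finset.mem_filter.2 ⟨hQ, ?_⟩
    obtain ⟨s, hs⟩ := TreeLike.exists_shown_ge G hder hr hle hcare hQcl.isClique hQne (hQcl.card_eq ▸ hpt)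
    exact ⟨s, hs⟩

end Summit.PneNP.PneNP.Theorems.RamseyUncertifiableResolutionUncertainty
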